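import Literature.ModelTheory.FiniteModelTheory.CohomologicalConsistency
import HarnessLib

/-!
# Cohomological `k`-consistency is invariant under isomorphism and renaming of symbols

Topic `Literature/ModelTheory/FiniteModelTheory`; support file for the discharge of
`LichterPago2025_cohomologyFooled` (`CohomologicalConsistencyLimits.lean`): Ó Conghaile's
`A →^ℤ_k B` (`CohomologicallyKConsistent`, Definition 5) and the existence of homomorphisms only
depend on the structures up to isomorphism and on WHICH relations the symbols denote, not on the
names of the symbols.  Precisely, let `eA : A' ≃ A`, `eB : B' ≃ B` be bijections and
`φ : L'.Relations n → L.Relations n` a map of relation symbols, SURJECTIVE in every arity, such that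
`RelMap r' x ↔ RelMap (φ r') (eA ∘ x)` on `A'`/`A` and likewise on `B'`/`B` (the `L'`-structures are
the pull-backs of the `L`-structures along `eA, eB, φ`).  Then

* `CohomologicallyKConsistent.transport`: `A →^ℤ_k B` (for `L`) implies `A' →^ℤ_k B'` (for `L'`):
  a self-supporting family `𝓢` on `(A, B)` (Observation 22 form) is pulled back context by context
  (`U' ↦ U'.map eA`, sections composed with `eA, eB`), and a `ℤ`-linear section `r` witnessing
  `ℤext` is pushed forward by `Finsupp.mapDomain` along the induced bijection of sections;
* `isEmpty_hom_transport`: if there is no homomorphism `A → B` then there is none `A' → B'`.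

This is the (folklore) bookkeeping that moves the verdict of the algorithm from convenient abstract
universes (sums, sigma types, `Option`s) to the table format `RelTables ar n` on `Fin n` in which the
tree states `CSP(T)` and `CohomologyAccepts`.

## References

* [OConghaile2022] A. Ó Conghaile, *Cohomology in constraint satisfaction and structure
  isomorphism*, MFCS 2022 = arXiv:2206.15253, Def. 5, Observation 22.
-/

namespace Literature.ModelTheory.FiniteModelTheory

open FirstOrder FirstOrder.Language FirstOrder.Language.Structure

universe u v u' v'

namespace CkcTransport

variable {L : Language} {L' : Language}
variable {A : Type u} {B : Type v} {A' : Type u'} {B' : Type v'}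
variable (eA : A' ≃ A) (eB : B' ≃ B)

/-! ### Transport of contexts and sections -/

/-- The context of `A` corresponding to a context of `A'`. [folklore] -/
def ctx (U' : Finset A') : Finset A := U'.map eA.toEmbedding

variable {eA}

/-- Membership in the transported context. [folklore] -/
theorem mem_ctx {U' : Finset A'} {x : A} : x ∈ ctx eA U' ↔ eA.symm x ∈ U' := by
  unfold ctx
  rw [Finset.mem_map]
  constructor
  · rintro ⟨y, hy, rfl⟩
    simpa using hy
  · intro h
    exact ⟨eA.symm x, h, by simp⟩

/-- Images of points of a context lie in the transported context. [folklore] -/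
theorem apply_mem_ctx {U' : Finset A'} {y : A'} (hy : y ∈ U') : eA y ∈ ctx eA U' :=
  mem_ctx.2 (by simpa using hy)

/-- Transport of contexts preserves cardinality. [folklore] -/
theorem card_ctx (U' : Finset A') : (ctx eA U').card = U'.card := Finset.card_map _

/-- Transport of contexts is monotone. [folklore] -/
theorem ctx_mono {D' U' : Finset A'} (h : D' ⊆ U') : ctx eA D' ⊆ ctx eA U' :=
  Finset.map_subset_map.2 h

variable (eA)

/-- Pull a section over `U'` (values in `B'`) back to a section over the transported context
(values in `B`). [folklore] -/
def pull {U' : Finset A'} (s' : ↥U' → B') : ↥(ctx eA U') → B :=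
  fun x => eB (s' ⟨eA.symm x, mem_ctx.1 x.2⟩)

/-- Push a section over the transported context forward to a section over `U'`. [folklore] -/
def push {U' : Finset A'} (s : ↥(ctx eA U') → B) : ↥U' → B' :=
  fun y => eB.symm (s ⟨eA y, apply_mem_ctx y.2⟩)

variable {eA eB}

/-- `pull ∘ push = id`. [folklore] -/
theorem pull_push {U' : Finset A'} (s : ↥(ctx eA U') → B) : pull eA eB (push eA eB s) = s := by
  funext x
  unfold pull push
  rw [Equiv.apply_symm_apply]
  congr 1
  exact Subtype.ext (by simp)

/-- `push ∘ pull = id`. [folklore] -/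
theorem push_pull {U' : Finset A'} (s' : ↥U' → B') : push eA eB (pull eA eB s') = s' := by
  funext y
  unfold pull push
  rw [Equiv.symm_apply_apply]
  congr 1
  exact Subtype.ext (by simp)

/-- `push` is injective. [folklore] -/
theorem push_injective (U' : Finset A') : Function.Injective (push eA eB (U' := U')) :=
  fun s t h => by rw [← pull_push s, h, pull_push]

/-- Pushing commutes with restriction. [folklore] -/
theorem restrict_push {D' U' : Finset A'} (h : D' ⊆ U') (s : ↥(ctx eA U') → B) :
    SectionSystem.restrict h (push eA eB s) =
      push eA eB (SectionSystem.restrict (ctx_mono h) s) := by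
  funext y
  rfl

/-! ### Transport of section systems -/

/-- The pulled-back section system on `(A', B')`. [folklore] -/
def sys (eA : A' ≃ A) (eB : B' ≃ B) (S : SectionSystem A B) : SectionSystem A' B' :=
  fun U' => {s' | pull eA eB s' ∈ S (ctx eA U')}

/-- Membership in the pulled-back section system unfolded. [folklore] -/
theorem mem_sys {S : SectionSystem A B} {U' : Finset A'} {s' : ↥U' → B'} :
    s' ∈ sys eA eB S U' ↔ pull eA eB s' ∈ S (ctx eA U') := Iff.rfl

variable [L.Structure A] [L.Structure B] [L'.Structure A'] [L'.Structure B']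
variable (φ : ∀ {n : ℕ}, L'.Relations n → L.Relations n)

/-- **Partial homomorphisms pull back** along the symbol map `φ` and the bijections.
[cite: OConghaile2022, §3.1 (k-local homomorphisms)] -/
theorem isPartialHom_of_pull
    (hA : ∀ {n : ℕ} (r' : L'.Relations n) (x : Fin n → A'), RelMap r' x ↔ RelMap (φ r') (eA ∘ x))
    (hB : ∀ {n : ℕ} (r' : L'.Relations n) (y : Fin n → B'), RelMap r' y ↔ RelMap (φ r') (eB ∘ y))
    {U' : Finset A'} {s' : ↥U' → B'} (h : IsPartialHom L (pull eA eB s')) : IsPartialHom L' s' := by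
  intro n r' x' hx'
  let x : Fin n → ↥(ctx eA U') := fun i => ⟨eA (x' i), apply_mem_ctx (x' i).2⟩
  have h1 : RelMap (φ r') (fun i => (x i : A)) := (hA r' _).1 hx'
  have h2 := h (φ r') x h1
  have h3 : (pull eA eB s' ∘ x) = eB ∘ (s' ∘ x') := by
    funext i
    show eB (s' ⟨eA.symm (eA (x' i)), _⟩) = eB (s' (x' i))
    congr 2
    exact Subtype.ext (by simp)
  rw [h3] at h2
  exact (hB r' _).2 h2

/-- The pulled-back system of a subsystem of `𝓗_k(A,B)` is a subsystem of `𝓗_k(A',B')`.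
[cite: OConghaile2022, §3.1] -/
theorem sys_le_homSystem {k : ℕ}
    (hA : ∀ {n : ℕ} (r' : L'.Relations n) (x : Fin n → A'), RelMap r' x ↔ RelMap (φ r') (eA ∘ x))
    (hB : ∀ {n : ℕ} (r' : L'.Relations n) (y : Fin n → B'), RelMap r' y ↔ RelMap (φ r') (eB ∘ y))
    {S : SectionSystem A B} (hS : S ≤ homSystem L k A B) : sys eA eB S ≤ homSystem L' k A' B' := by
  intro U' s' hs'
  obtain ⟨hcard, hhom⟩ := hS _ (mem_sys.1 hs')
  exact ⟨(card_ctx U').symm.le.trans hcard, isPartialHom_of_pull φ hA hB hhom⟩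

/-- **`ℤ`-extendability pulls back**: push the `ℤ`-linear section forward along the bijection of
sections `push`. [cite: OConghaile2022, §4.2 (ℤext)] -/
theorem zext_sys [DecidableEq A] [DecidableEq A'] {k : ℕ} {S : SectionSystem A B} {C' : Finset A'}
    {s' : ↥C' → B'} (h : SectionSystem.ZExt k S (ctx eA C') (pull eA eB s')) :
    SectionSystem.ZExt k (sys eA eB S) C' s' := by
  classical
  obtain ⟨r, ⟨hsupp, hcompat⟩, hbase⟩ := h
  refine ⟨fun U' => Finsupp.mapDomain (push eA eB) (r (ctx eA U')), ⟨?_, ?_⟩, ?_⟩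
  · intro U' t' ht'
    obtain ⟨t, ht, rfl⟩ := Finset.mem_image.1
      (Finsupp.mapDomain_support (Finsupp.mem_support_iff.2 ht'))
    rw [mem_sys, pull_push]
    exact hsupp _ t (Finsupp.mem_support_iff.1 ht)
  · intro D' U' hDU hU
    have hc : (ctx eA U').card ≤ k := (card_ctx U').le.trans hU
    show Finsupp.mapDomain (SectionSystem.restrict hDU) (Finsupp.mapDomain (push eA eB) (r (ctx eA U'))) =
      Finsupp.mapDomain (push eA eB) (r (ctx eA D'))
    rw [← hcompat (ctx_mono hDU) hc, ← Finsupp.mapDomain_comp, ← Finsupp.mapDomain_comp]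
    rfl
  · show Finsupp.mapDomain (push eA eB) (r (ctx eA C')) = Finsupp.single s' 1
    rw [hbase, Finsupp.mapDomain_single, push_pull]

/-- A section system over the empty context: the transported membership (the empty context is
mapped to the empty context). [folklore] -/
theorem mem_of_eq_empty {S : SectionSystem A B} {s : ↥(∅ : Finset A) → B} (hs : s ∈ S ∅)
    {E : Finset A} (hE : E = ∅) (t : ↥E → B) : t ∈ S E := by
  subst hE
  have : t = s := funext fun x => absurd x.2 (Finset.notMem_empty _)
  rw [this]; exact hs

end CkcTransport

open CkcTransport in
/-- **Cohomological `k`-consistency is invariant under isomorphism and surjective renaming of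
symbols.**  If `A →^ℤ_k B` for `L`-structures and the `L'`-structures `A', B'` are the pull-backs of
`A, B` along bijections `eA, eB` and a symbol map `φ` (which need not hit every `L`-symbol: fewer
constraints only help), then `A' →^ℤ_k B'`. [cite: OConghaile2022, Def. 5 and Observation 22] -/
theorem CohomologicallyKConsistent.transport {L : Language} {L' : Language} {k : ℕ}
    {A : Type u} {B : Type v} {A' : Type u'} {B' : Type v'}
    [L.Structure A] [L.Structure B] [L'.Structure A'] [L'.Structure B'] [DecidableEq A]
    [DecidableEq A'] (eA : A' ≃ A) (eB : B' ≃ B) (φ : ∀ {n : ℕ}, L'.Relations n → L.Relations n)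
    (hA : ∀ {n : ℕ} (r' : L'.Relations n) (x : Fin n → A'), RelMap r' x ↔ RelMap (φ r') (eA ∘ x))
    (hB : ∀ {n : ℕ} (r' : L'.Relations n) (y : Fin n → B'), RelMap r' y ↔ RelMap (φ r') (eB ∘ y))
    (h : CohomologicallyKConsistent L k A B) : CohomologicallyKConsistent L' k A' B' := by
  classical
  obtain ⟨S, hS, ⟨U₀, s₀, hs₀⟩, hz⟩ := (cohomologicallyKConsistent_iff_zext L k A B).1 h
  -- the family contains the empty section
  have hempty : SectionSystem.restrict (Finset.empty_subset U₀) s₀ ∈ S ∅ :=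
    (hz hs₀).restrict_mem (hS _ hs₀).1 (Finset.empty_subset U₀)
  refine (cohomologicallyKConsistent_iff_zext L' k A' B').2 ⟨sys eA eB S,
    sys_le_homSystem φ hA hB hS, ⟨∅, fun x => absurd x.2 (Finset.notMem_empty _), ?_⟩,
    fun C' s' hs' => zext_sys (hz (mem_sys.1 hs'))⟩
  exact mem_of_eq_empty hempty (Finset.map_empty _) _

open CkcTransport in
/-- **Non-existence of homomorphisms transports** along the same data: a homomorphism `A' → B'`
composed with the bijections is a homomorphism `A → B` (every `L`-symbol is a renamed `L'`-symbol).
[folklore] -/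
theorem isEmpty_hom_transport {L : Language} {L' : Language}
    {A : Type u} {B : Type v} {A' : Type u'} {B' : Type v'}
    [L.Structure A] [L.Structure B] [L'.Structure A'] [L'.Structure B'] [L.IsRelational]
    (eA : A' ≃ A) (eB : B' ≃ B) (φ : ∀ {n : ℕ}, L'.Relations n → L.Relations n)
    (hφ : ∀ {n : ℕ} (r : L.Relations n), ∃ r' : L'.Relations n, φ r' = r)
    (hA : ∀ {n : ℕ} (r' : L'.Relations n) (x : Fin n → A'), RelMap r' x ↔ RelMap (φ r') (eA ∘ x))
    (hB : ∀ {n : ℕ} (r' : L'.Relations n) (y : Fin n → B'), RelMap r' y ↔ RelMap (φ r') (eB ∘ y))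
    (h : IsEmpty (A →[L] B)) : IsEmpty (A' →[L'] B') := by
  refine ⟨fun F' => h.false ⟨eB ∘ F' ∘ eA.symm, fun {n} f => isEmptyElim f, ?_⟩⟩
  intro n r x hx
  obtain ⟨r', rfl⟩ := hφ r
  have h1 : RelMap r' (eA.symm ∘ x) := by
    rw [hA r']
    convert hx using 1
    funext i; simp
  have h2 := F'.map_rel r' _ h1
  rw [hB r'] at h2
  exact h2

end Literature.ModelTheory.FiniteModelTheory
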